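import Summits.BirchSwinnertonDyer.Rank1Residual.F1Sign2.BlindSpotLocalLawsAtTwoGood
import Summits.BirchSwinnertonDyer.BirchSwinnertonDyer.Theorems.ByReductionTypeAtTwoRankOneAtTwoOneDoorLawBottomDefs
import Summits.BirchSwinnertonDyer.Rank1Residual.F1Sign2.KummerEntanglementAtTwo
import Literature.NumberTheory.EllipticCurves.Tamagawa
import Literature.NumberTheory.EllipticCurves.SelmerTorsionInclusion
import HarnessLib

/-!
# Cell `bsd-f1-sign2`, ES-23: THE ADDITIVE-AT-2 LAW OF THE ČEBOTAREV BLIND SPOT IN CLOSED FORM — `x₂(E)` at additive reduction at 2 with `c₂` odd, read off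
`(nr, Δ mod squares, v₂Δ, v₂c₄, c₄′c₆′ mod 4)`; the blind-spot bit decided on the whole `23715` slice (-es g14, MEMO-es §23)

TYPER PORT (cell `bsd-f1-sign2`, seat `-ty` g12) of -es g14's sketch `HOME/data-es/g14/Sketch23.lean` cf7eafc576ca9b73 (MEMO-es §23, `data-es/g14/MEMO-es-23.md`; -es:
farm rc 0 · 0 sorry; BC7 `Probe23` 11/11 CLEAN; crux idea `twist-transport-additive-blind-spot-law-at-two` commit 8a7da63926fa; STATUS DONE 2026-08-28T19:22:59Z).
MERGE as announced by the sketch («the frame declarations `primePlace`, `DiesOnDivisionField` and g13's U₃-law `BlindSpotNotKummerAtTwoAdditiveUnramifiedCubic`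
are repeated VERBATIM so that this file elaborates on its own; the -ty port merges them»): this file IMPORTS the tree's `F1Sign2/BlindSpotLocalLawsAtTwoGood.lean`
(p660125; which imports `F1Sign2/BlindSpotLocalLawsAtTwo.lean` p652787), OPENS both namespaces and DROPS the three repeated declarations; everything else (with ONE REF1-mandated statement repair, S-23q ↦ C′, below) —
the frame abbreviations `AdditiveOddAtTwo`, `NoTwoTorsionAtTwo`, `DeltaClass`, `TameCubicExceptional`, `HasTwoTorsionAtTwo`, `DeltaRamifiedAtTwo`,
`NoTwoTorsionAtTwoTameCubic`, `AdditiveLawAtTwo`, the typed rows ES-23a `BlindSpotKummerAtTwoAdditiveTameCubicIff`, ES-23c `BlindSpotKummerAtTwoAdditiveTorsionRamifiedIff`,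
ES-23d `BlindSpotKummerAtTwoAdditiveTorsionUnramifiedIff`, ES-23z `BlindSpotLocallyTrivialAtTwoOfDeepJ`, ES-23 `BlindSpotBitAtTwoAdditiveDecided`, S-23t
`NoTwoTorsionAtTwoTameCubic`, S-23q `DeltaSquareClassTrichotomyAtTwo`, ES-23g `BlindSpotSelmerIffKummerAtTwoOnAdditiveThinFamily`, ES-23h
`ShaTwoNontrivialOnAdditiveThinFamily`, ES-23i `BlindSpotIsKummerImageOnAdditiveThinFamilyOfShaTwoTrivial` (all PLAIN support `def`s, nothing asserted) and the
PROVED glue `four_pow_mul_ne_of_lt`, `deltaClass_one_five_disjoint`, `blindSpotBitAtTwoAdditiveDecided_of`, `blindSpotIsKummerImageOnAdditiveThinFamily_of` —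
VERBATIM, in the new namespace `…Rank1Residual.F1Sign2.BlindSpotLocalLawsAtTwoAdditive` (file-named, as ES-22's).  Two cite-KEY repairs (keys only, loci kept):
`KramerTAMS1981` → `Kramer1981`, `SerreCorpsLocaux1962` → `Serre1979` (references.bib has no such keys; same works).  BC5 witness = two populations × two engines
(MEMO-es §23.3): F21 (kit j312155, 1 002 slice-additive rows; PARI `es21.gp` v. the exact 2-adic python engine `data-es/g14/engine23.py`, agreeing on (nr, x₂, z₂)
1 002/1 002) and FAM = all 1 640 Cremona curves (N < 5·10⁵) with 4 ∣ N, every odd bad prime additive, odd torsion, odd Tamagawa product, Δ < 0 (law FITTED on F21,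
TESTED on FAM 1 640/1 640; overlap 16); Kodaira data by the independent `tate2.py` 2 814/2 814; twist-invariance of z₂ on 1 001/1 001 orbits (kit j315610); global
BSD-consistency on FAM ∩ {ρ̄_{E,4} onto} (440): rank-0 ∧ x₂ = 1: 16/16 have 4 ∣ Ш_an; rank 1: 96/96 ξ_E = δ(P_gen); rank 2: 8/8; x₂ = 0 ∧ rank ≥ 1: 105/105
ξ_E ∉ δ(E(ℚ)); 0 violations (`data-es/g14/` SHA16.txt).  Cheapest falsifiers run (MEMO-es §23.8): 0/1 002, 0/1 640, 0/16, 0/105, 0/1 001.  Why novel (-es,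
MEMO-es §23.9, both corpora searched): the literature computes dim Sel₂ changes under twist via norm indices (Kramer, Mazur–Rubin, Klagsbrun) and the Kummer
image case by case at semistable or «nice» places (Brumer–Kramer, BPT, Yoo–Yu); a closed-form position of the SPECIFIC entanglement class ξ_E relative to δ₂
at wild additive reduction, read off (v₂Δ, v₂c₄, c₄′c₆′), with its BSD-shadow (4 ∣ #Ш on a rank-0 family) is not in the corpora searched.  Nothing here proves
BSD; 23715 not closed.
REF1 §135 (refuter-bsd-f1-sign2-ref1 g12, D-ty-15, `HOME/REF1-AUDIT-v1.md` l.2611, evidence `REF1-data/b135/` SHA16.txt incl. `lean/Probe135.lean` 9c11031c64c35798,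
2026-08-28T19:57:00Z): GATE AMBER → GREEN after ONE mandatory repair R1, APPLIED HERE: **S-23q `DeltaSquareClassTrichotomyAtTwo` KILLED-misstated AS -es TYPED IT**
(no reduction hypothesis; witness 1055a1, see its docstring) and RETYPED as REF1's C′ (`AdditiveOddAtTwo W →` in place of the surjectivity binder; THEOREM-GRADE),
with the one glue call patched `hq W ⟨hng, hnm, hodd⟩ hT` (REF1 P3, kernel-checked, std axioms) — as -es typed it the glue's hypothesis list was unsatisfiable,
so the reduction «ES-22fα + ES-23a/c/d + S-23t + S-23q ⟹ ES-23» was vacuous; it is not any more.  (R2) port from disk cf7eafc576ca9b73 incl. the §23.12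
addendum `DeepTwistCell` + ES-23z′ `BlindSpotLocallyTrivialAtTwoAdditiveIff` + `blindSpotLocallyTrivialAtTwoOfDeepJ_of_iff` — done (this file).  ALL OTHER 11
Props SURVIVE: ES-23a/c/d/z′ empirical (literal Lean-predicate replay from a-invariants with an independent Hensel root count: invariants + nr 2 642⁄2 642,
x₂ = `AdditiveLawAtTwo` 2 642⁄2 642 (= PARI 1 002⁄1 002), z₂ = ES-23z′ RHS 1 672⁄1 672; out-of-sample box of 12 490 additive c₂-odd minimal curves → the SAME
28 cells, -es engine vs typed laws 1 670⁄1 670, 0 S-23t⁄S-23q⁄U₃ violations — a 4th population: 15 625 + 1 670 evaluations, 0 exceptions); S-23t THEOREM-GRADE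
and true as typed (box 234 207 curves, 0 violations; THEOREM-CANDIDATE, tame cubic); ES-23g THEOREM-GRADE on paper (THEOREM-CANDIDATE on paper); ES-23h⁄i
conjecture-grade via the law (BSD-consistency 16⁄16; the 5 even-Ш rank-0 x₂ = 0 curves all have ρ_{E,8} not onto); c₄ = 0 corner consistent (law ⇒ x₂ = 1,
1 117 rows).  PARTITION none; beyond-print theorem no; BSD not proved.
REF2 v40-add2 §1.4 REF2_TXT_ES23 (refuter-bsd-f1-sign2-ref2 g40, `HOME/REF2-PLACEMENT-v40-add2.md` f0719771714c3ed5, 2026-08-28T19:35:24Z; ASK D-ty-16), verbatim: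
«REF2 v40-add2 §1, placement: the additive-at-2 laws ES-23a/c/d/z/z′ and the assembled ES-23 are NOT IN PRINT as statements — no printed statement positions
a named class of H¹(ℚ₂,E[2]) relative to im δ₂ at wild additive reduction in Kraus's invariants (v₂Δ, v₂c₄, c₄′c₆′); Brumer–Kramer 1977 §§3–4 unseen
(acq-01909). The levers are printed AT 2: the twist dictionary δ₂(E) ∩ δ₂(E^{(d)}) = N E(ℚ₂(√d))⁄2E(ℚ₂) [cite: Kramer1981, Prop. 7] [cite: MazurRubin2010, Lemma 2.9];
the supersingular norm indices i_d(E₀) = 0 for v(d) even, = 1 for v(d) odd, VERBATIM [cite: Kramer1981, Prop. 4] (so the (±1,±5,±2,±10)-twist orbits of good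
supersingular curves — ES-23a ∧ v₂c₄ ≥ 6, the II*(4,12) cell — are decided on paper given ES-22a; its parity clause gives Δ(E₀) ≡ 5 (8), the u = 5 cells);
Kraus's classification at 2 [cite: Kraus1989]; φ-descent images for the nr = 1 shadow (Lemma A) [cite: SilvermanAEC2009, X.§4 Prop. 4.9]; local constancy of
Selmer conditions in the 2-adic topology for ES-23z (threshold value 15 and the DeepTwistCell digit are census). House grade NEW-COMBINATION (as ES-22, REF2
v38 §2); beyond-print CANDIDATE yes-small for the Kramer-decided sub-cells, census-grade for the 8 empirical cells (fine class in ℚ₂(√Δ)^×⁄□, c₄′c₆′ residue,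
v₂c₄ ≠ 5, the U₃ law); ES-23g/h/i are uses of the law, not in print as statements. Niceness at 2 [cite: YooYu2022, Prop. 1.8, Prop. 4.4, Lemma 4.3] HOLDS for
nr = 0 but is uninformative (M_{1,2} = 1, M_{2,2} = H¹(ℚ₂,E[2])). PARTITION: none moved; beyond-print theorem: no; BSD not proved; 23715 not closed.»
REF2 v40-add2 §1.3 (a correction of a READING of print, statements unaffected): for nr = 0 (E(ℚ₂)[2] = 0, L₂ a cubic field) E IS nice at 2 (Yoo–Yu Prop. 1.8,
4.4) but vacuously so — Lemma 4.3 gives M_{1,2} = {1}, |im δ₂| = 2, M_{2,2} = ker N, so the sandwich locates nothing; what -es's H1 kills is g13's heuristic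
identification «κ = the unramified class», never asserted in print.  Cite slots per §1.5: `KramerTAMS1981` ↦ `Kramer1981` (Prop. 7 ✓), ADD Kramer 1981
Prop. 4 + Mazur–Rubin 2010 Lemma 2.9 on the supersingular-dictionary docstring, ES-23g's «Kramer Prop. 3» slot ↦ Silverman AEC VII.2.1, VII.3.1, VII.5.1(c).
PARTITION: none moved; beyond-print theorem: no; BSD not proved.

## The sketch's own summary (verbatim)

# MEMO-es §23 (cell `bsd-f1-sign2`, -es g14) — THE ADDITIVE-AT-2 LAW OF THE ČEBOTAREV BLIND SPOT, IN CLOSED FORM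

Sketch (statement file + kernel glue; nothing here proves BSD).  Continues g13's `Sketch22.lean` (same namespace; the frame declarations
`primePlace`, `DiesOnDivisionField` and g13's U₃-law `BlindSpotNotKummerAtTwoAdditiveUnramifiedCubic` are repeated VERBATIM so that this file
elaborates on its own; the -ty port merges them).

THE OBJECT (unchanged).  `ρ_{E,2^∞}` onto; `ξ_E ∈ H¹(ℚ, E[2])` the non-zero class dying on `Γ_{ℚ(E[4])}`, explicitly the class of `α_E = -Δ f'(θ)` in
`ker(N : L^*/L^{*2} → ℚ^*/ℚ^{*2})`, `L = ℚ[X]/(f)`, `f = X³ + b₂X² + 8b₄X + 16b₆`; `x_2(E) = [loc₂ ξ_E ∈ δ₂(E(ℚ₂)/2)]`, `z_2(E) = [loc₂ ξ_E = 0]`.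
After §21–22 the blind-spot bit `b(E) = [ξ_E ∈ Sel₂(E)] = [Δ<0]·x_2·∏_{p ∣ Δ odd} x_p` was explicit on the whole `23715` slice EXCEPT for `x_2` at ADDITIVE
reduction at `2` (g13's table: two cells mixed).  §23 closes that gap.

THE LAW (ES-23; `c₂` odd, `ρ̄_{E,2}` onto; invariants of the minimal model: `nr` = number of roots of `f` in `ℚ₂`, `u = Δ/2^{v₂Δ} mod 8`, `v₂(c₄)`,
`c₄' = c₄/2^{v₂c₄}`, `c₆' = c₆/2^{v₂c₆}`):
* `nr = 0`, `Δ ∈ 4^k(1+8ℤ₂)` (`L₂ = U₃`, the unramified cubic field):  `x_2 = 0`                                   (g13 ES-22fα; 193/193)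
* `nr = 0`, `Δ ∈ 4^k(5+8ℤ₂)` (`L₂ = R₃ = ℚ₂(2^{1/3})`):  `x_2 = 1` UNLESS `v₂(Δ) = 6` and (`v₂(c₄) = 6`, or `v₂(c₄) = 5` with `c₄'c₆' ≡ 1 (mod 4)`)   (ES-23a)
* `nr = 1`, `ℚ₂(√Δ)/ℚ₂` ramified:  `x_2 = 1` iff `v₂(Δ) = 6` and `Δ/64 ≡ 7 (mod 8)`                                              (ES-23c)
* `nr = 1`, `Δ ∈ 4^k(5+8ℤ₂)` (`ℚ₂(√Δ)` unramified; then `v₂(Δ) = 4`):  `x_2 = 0` iff `v₂(c₄) = 5`                               (ES-23d)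
* `v₂(j) ≥ 15`:  `z_2 = 1` (hence `x_2 = 1`)                                                                                    (ES-23z)
CENSUS = two populations, two engines: F21 (kit `j312155`, 1002 slice-additive rows; PARI `es21.gp` v. the exact `2`-adic python engine `engine23.py`
(cubic arithmetic in `R₃`/`U₃`, quadratic in `ℚ₂ × ℚ₂(√Δ)`), agreeing on (nr, x_2, z_2) for 1002/1002) and FAM = ALL 1640 curves of Cremona's table
(`N < 500 000`) with `4 ∣ N`, every odd bad prime additive, odd torsion, odd Tamagawa product, `Δ < 0` (`engine23.py`; the law was FITTED on F21 and is
TESTED on FAM: 1640/1640, label overlap 16).  Kodaira/conductor data by an independent Tate-algorithm implementation `tate2.py` (2814/2814 v. F21).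
STRUCTURE (MEMO-es §23.4–23.6): (i) `ξ` is twist-invariant (`α_{E^d} = d⁸α_E`): kit `j315610`, all 8 local twists of 1001 curves, `z_2` constant on
every orbit; (ii) the supersingular dictionary: for `E₀` good supersingular at `2`, `x_2(E₀^{(d)}) = z_2(E₀) ∨ [i_d(E₀) = 0]`, `i_d` = Kramer's local norm
index of `E₀` at `ℚ₂(√d)` (`δ₂(E₀) ∩ δ₂(E₀^d) = N E₀(ℚ₂(√d))`, Kramer 1981 Prop. 7 / Mazur–Rubin), and the table forces `i_{-1} = i_{-5} = 0`,
`i_{±2} = i_{±10} = 1` — this IS the II*(4,12) cell (`= (E₀ ss)^{(-1)}`, 65/65 `x_2 = 1`) and the `v₂(c₄) ≥ 6` part of the II(6,6) cell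
(`= (E₀ ss)^{(±2)}`, `x_2 = z_2(E₀)`); (iii) the `φ̂`-shadow `sh(loc₂ξ_E) = χ_{-Δ}` (g13 Lemma A) alone decides 7 of the 11 `nr = 1` cells.
GLOBAL TEST (BSD-consistency by invariants independent of every local engine, MEMO-es §23.7): on FAM with `ρ̄_{E,4}` onto (440 curves) the law predicts
`b(E) = x_2(E)`; `x_2 = 1` & rank 0: 16 curves, `Ш_an ∈ {4 (9×), 16 (6×), 100 (1×)}` — all divisible by 4; `x_2 = 1` & rank 1: `ξ_E = δ(P_gen)` certified
in `ℚ(θ)` 96/96; rank 2: 8/8 `ξ_E ∈ δ(E(ℚ))`; `x_2 = 0` & rank ≥ 1: `ξ_E ∉ δ(E(ℚ))` 105/105; `x_2 = 0` & rank 0: `Ш_an` odd 210/215, `∈ {4,16}` 5.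
-/

set_option autoImplicit false

noncomputable section

open scoped Classical

namespace Summit.BirchSwinnertonDyer.Rank1Residual.F1Sign2.BlindSpotLocalLawsAtTwoAdditive

open WeierstrassCurve NumberField IsDedekindDomain
open Literature.NumberTheory.EllipticCurves Literature.NumberTheory.EllipticCurves.ModularForms
open Literature.NumberTheory.GaloisRepresentations
open Summit.BirchSwinnertonDyer.Rank1Residual.F1Sign2.BlindSpotLocalLawsAtTwo
open Summit.BirchSwinnertonDyer.Rank1Residual.F1Sign2.BlindSpotLocalLawsAtTwoGood

/-! The frame declarations `primePlace`, `DiesOnDivisionField` (ES-21 file, p652787) and g13's ES-22fα `BlindSpotNotKummerAtTwoAdditiveUnramifiedCubic`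
(ES-22 file, p660125) are the TREE's — opened above, not restated (the sketch repeats them verbatim only to elaborate stand-alone). -/

/-- Frame abbreviation: `E` has ADDITIVE reduction at `2` with ODD local Tamagawa number `c₂` (the additive-at-2 part of the `23715` slice). -/
def AdditiveOddAtTwo (W : WeierstrassCurve ℚ) [W.IsElliptic] : Prop :=
  ¬ W.HasGoodReductionAtPrime 2 ∧ ¬ W.HasMultiplicativeReductionAtPrime 2 ∧ Odd ((W.baseChange ℚ_[2]).localTamagawaNumber ℤ_[2])

/-- Frame abbreviation: `f` has NO root in `ℚ₂` (`E(ℚ₂)[2] = 0`; then `L ⊗ ℚ₂` is a cubic field, tame: `U₃` or `R₃`). -/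
def NoTwoTorsionAtTwo (W : WeierstrassCurve ℚ) [W.IsElliptic] : Prop :=
  ∀ P : (W.baseChange ℚ_[2]).toAffine.Point, 2 • P = 0 → P = 0

/-- Frame abbreviation: `Δ ∈ 4^k · (r + 8ℤ)` for an odd residue `r` (the square class of `Δ` in `ℚ₂^*/ℚ₂^{*2}` when `r ∈ {1,3,5,7}`). -/
def DeltaClass (W : WeierstrassCurve ℚ) (r : ℤ) : Prop :=
  ∃ (k : ℕ) (m : ℤ), W.Δ = (4 : ℚ) ^ k * m ∧ m % 8 = r

/-- The exceptional sub-cell of the tame-cubic law (Kodaira II, `f₂ = v₂(Δ) = 6`, the only mixed cell of g13's table): `v₂(Δ) = 6` and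
(`v₂(c₄) = 6`, or `c₄ = 32m`, `c₆ = 64n` with `mn ≡ 1 (mod 4)`).  On it `x_2 = 0`; its two halves are the `(±2)`-twists of good SUPERSINGULAR curves with
`z_2 = 0` (`v₂(c₄) = 6`; Kramer index `i_{±2} = 1`) and half of the `(±2)`-twists of Kodaira-III* curves (`v₂(c₄) = 5`).
[cite: Kramer1981, Prop. 4, Prop. 7] [cite: MazurRubin2010, Lemma 2.9] (REF2 v40-add2 §1.5: the supersingular norm indices i_d(E₀) are Kramer's Prop. 4 verbatim) -/
def TameCubicExceptional (W : WeierstrassCurve ℚ) : Prop :=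
  padicValRat 2 W.Δ = 6 ∧ (padicValRat 2 W.c₄ = 6 ∨ ∃ (m n : ℤ), W.c₄ = 32 * m ∧ W.c₆ = 64 * n ∧ (m * n) % 4 = 1)

/-- **ES-23a `BlindSpotKummerAtTwoAdditiveTameCubicIff` (candidate, EMPIRICAL two populations / two engines, NEW; supersedes g13's ES-22fβ which excluded
`v₂(Δ) = 6`): additive reduction at `2`, `c₂` odd, no `ℚ₂`-rational `2`-torsion, `Δ ∈ 4^k(5+8ℤ)` (`L₂ = ℚ₂(2^{1/3})`, `H¹(ℚ₂,E[2]) ≅ (ℤ/2)²`, `|δ₂| = 2`)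
⇒ the blind spot is Kummer at `2` iff NOT `TameCubicExceptional`.**  Census F21: I0*(4,8) 35, II*(4,12) 65, II*(6,14) 23, IV*(2,8) 142, II(6,6)∧v₂c₄≥7 10,
II(6,6)∧v₂c₄=5∧c₄'c₆'≡3 (4) 16 — all `x_2 = 1`; II(6,6)∧v₂c₄=6 15, II(6,6)∧v₂c₄=5∧c₄'c₆'≡1 (4) 14 — all `x_2 = 0`; FAM: 30+138+140+300+112+26 `x_2 = 1`,
32+26 `x_2 = 0`; 0 exceptions in 320 + 804 rows.  Why it might fail: the residue condition `c₄'c₆' mod 4` was mined from 30 + 52 rows of ONE sub-cell and a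
II(6,6) curve with `v₂(c₄) = 5` outside both populations' residue patterns could break it; the `R₃` cells with `(f₂, v₂Δ) ∉ {(4,8),(4,12),(6,14),(2,8),(6,6)}`
(none in 2 814 + 1 640 curves) are extrapolated.  Cheapest falsifier: one tame-cubic additive curve with `x_2 ≠ [¬ TameCubicExceptional]` (PARI `es21.gp` or
`engine23.py`, < 1 s per curve).  [cite: Kraus1989] [cite: SilvermanAEC2009, IV.§9 (Tate's algorithm), X.§4] [cite: Kramer1981, Prop. 7] -/
def BlindSpotKummerAtTwoAdditiveTameCubicIff : Prop :=
  ∀ (W : WeierstrassCurve ℚ) [W.IsElliptic] [W.IsGloballyMinimal], (∀ n : ℕ, W.HasSurjectiveModNGaloisRep ((2 ^ n : ℕ) : ℤ)) →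
    AdditiveOddAtTwo W → NoTwoTorsionAtTwo W → DeltaClass W 5 →
    ∀ x : galH1Torsion W ((2 ^ 1 : ℕ) : ℤ), x ≠ 0 → DiesOnDivisionField W 1 2 x →
      (x ∈ selmerLocalKer W ((primePlace 2).adicCompletion ℚ) ((2 ^ 1 : ℕ) : ℤ) ↔ ¬ TameCubicExceptional W)

/-- Frame abbreviation: `E(ℚ₂)[2] ≠ 0` (with `Δ ∉ ℚ₂^{*2}` this means `f` has EXACTLY one root `θ₀ ∈ ℚ₂`; `L ⊗ ℚ₂ = ℚ₂ × ℚ₂(√Δ)`). -/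
def HasTwoTorsionAtTwo (W : WeierstrassCurve ℚ) [W.IsElliptic] : Prop :=
  ∃ P : (W.baseChange ℚ_[2]).toAffine.Point, P ≠ 0 ∧ 2 • P = 0

/-- Frame abbreviation: `ℚ₂(√Δ)/ℚ₂` is RAMIFIED, i.e. `v₂(Δ)` odd or `Δ/2^{v₂Δ} ≡ 3 (mod 4)`. -/
def DeltaRamifiedAtTwo (W : WeierstrassCurve ℚ) : Prop :=
  Odd (padicValRat 2 W.Δ) ∨ DeltaClass W 3 ∨ DeltaClass W 7

/-- **ES-23c `BlindSpotKummerAtTwoAdditiveTorsionRamifiedIff` (candidate, EMPIRICAL, NEW): additive at `2`, `c₂` odd, a `ℚ₂`-rational `2`-torsion point,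
`ℚ₂(√Δ)` ramified ⇒ the blind spot is Kummer at `2` iff `v₂(Δ) = 6` and `Δ/64 ≡ 7 (mod 8)` (the Kodaira-II cell with `M = ℚ₂(i)`).**  Census F21 (11 cells:
I0*(4,8)u3 12, u7 21; I0*(5,9) 15; II(6,6)u3 9; II(7,7) 27; II*(3,11) 118; IV*(2,8)u3 68, u7 65 — `x_2 = 0`; II(6,6)u7 10 — `x_2 = 1`) and FAM (I0*(4,8)u7 48,
I0*(5,9) 60, II(7,7) 100, II*(3,11) 82, IV*(2,8)u7 82 — `x_2 = 0`; II(6,6)u7 36 — `x_2 = 1`): 0 exceptions in 345 + 408 rows.  Mechanism (MEMO-es §23.5): with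
`T₀ = (θ₀,0)` and the `2`-isogeny `φ : E → E/⟨T₀⟩`, the étale shadow `sh(loc₂ ξ_E) = χ_{-Δ}` (g13 Lemma A) must lie in `δ_φ̂(E(ℚ₂))`; this alone gives
`x_2 = 0` on I0*(5,9), II(7,7), II*(3,11) (`v₂(-Δ)` odd, `δ_φ̂(E(ℚ₂)) ⊂` units); on I0*(4,8), II(6,6)u3, IV*(2,8) the shadow passes and the fine class in
`ℚ₂(√Δ)^*/□` decides.  Why it might fail: mined per Kodaira cell; an additive `nr = 1` curve with `(f₂, v₂Δ)` outside the 6 sampled pairs, e.g. `v₂(Δ) = 10`,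
is extrapolated (none in either population).  Cheapest falsifier: one such curve with `x_2 = 1` off the II(6,6)u7 cell.
[cite: SilvermanAEC2009, X.§4 Prop. 4.9] [cite: Kramer1981, Prop. 7] [cite: Kraus1989] -/
def BlindSpotKummerAtTwoAdditiveTorsionRamifiedIff : Prop :=
  ∀ (W : WeierstrassCurve ℚ) [W.IsElliptic] [W.IsGloballyMinimal], (∀ n : ℕ, W.HasSurjectiveModNGaloisRep ((2 ^ n : ℕ) : ℤ)) →
    AdditiveOddAtTwo W → HasTwoTorsionAtTwo W → DeltaRamifiedAtTwo W →
    ∀ x : galH1Torsion W ((2 ^ 1 : ℕ) : ℤ), x ≠ 0 → DiesOnDivisionField W 1 2 x →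
      (x ∈ selmerLocalKer W ((primePlace 2).adicCompletion ℚ) ((2 ^ 1 : ℕ) : ℤ) ↔ ∃ m : ℤ, W.Δ = 64 * m ∧ m % 8 = 7)

/-- **ES-23d `BlindSpotKummerAtTwoAdditiveTorsionUnramifiedIff` (candidate, EMPIRICAL, NEW): additive at `2`, `c₂` odd, a `ℚ₂`-rational `2`-torsion point,
`Δ ∈ 4^k(5+8ℤ)` (`ℚ₂(√Δ)` the unramified quadratic field; then `v₂(Δ) = 4`, Kodaira II(f₂=4) or IV(f₂=2)) ⇒ the blind spot is Kummer at `2` iff `v₂(c₄) ≠ 5`.**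
Census F21: II(4,4): `v₂c₄ = 5` 22 rows `x_2 = 0`, `v₂c₄ ≥ 6` 22 rows `x_2 = 1`; IV(2,4) (`v₂c₄ ≥ 6` always) 100 rows `x_2 = 1`; FAM: 20 / 116 / 292; 0 exceptions
in 144 + 428 rows.  Structure (kit `j315610`): II(4,4)∧v₂c₄=5 = the `(-1)`-twists of Kodaira-III curves, II(4,4)∧v₂c₄≥6 = the `(-1)`-twists of the IV(2,4)
curves; the shadow `χ_{-Δ} = χ_3 ∉ δ_φ̂(E(ℚ₂)) = {1,5}` kills the first, `δ_φ̂(E(ℚ₂)) = ℤ₂^*/□… = all units` on the second.  Why it might fail: `v₂(Δ) = 4` is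
forced in both populations but not assumed to be the only possibility in print; a `Δ ∈ 4^k(5+8ℤ)`, `nr = 1` additive curve with `v₂(Δ) ≥ 8` is extrapolated.
Cheapest falsifier: one II(4,4) curve with `v₂(c₄) ≥ 6` and `x_2 = 0`. [cite: SilvermanAEC2009, X.§4 Prop. 4.9] [cite: Kraus1989] -/
def BlindSpotKummerAtTwoAdditiveTorsionUnramifiedIff : Prop :=
  ∀ (W : WeierstrassCurve ℚ) [W.IsElliptic] [W.IsGloballyMinimal], (∀ n : ℕ, W.HasSurjectiveModNGaloisRep ((2 ^ n : ℕ) : ℤ)) →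
    AdditiveOddAtTwo W → HasTwoTorsionAtTwo W → DeltaClass W 5 →
    ∀ x : galH1Torsion W ((2 ^ 1 : ℕ) : ℤ), x ≠ 0 → DiesOnDivisionField W 1 2 x →
      (x ∈ selmerLocalKer W ((primePlace 2).adicCompletion ℚ) ((2 ^ 1 : ℕ) : ℤ) ↔ padicValRat 2 W.c₄ ≠ 5)

/-- **ES-23z `BlindSpotLocallyTrivialAtTwoOfDeepJ` (candidate, THEOREM-sketch by `2`-adic continuity, NEW): additive at `2` with `c₂` odd and `v₂(j) ≥ 15`
(`j = c₄³/Δ ≠ 0`) ⇒ `loc₂ ξ_E = 0`.**  Mechanism: as `c₄ → 0` `2`-adically with the reduction type fixed, `f → (X + b₂/3)³ + C` and `α_E = -Δ f'(θ) → 9·□`;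
squares are open (`U^{(7)} ⊂ U²` in `R₃`, `U^{(3)} ⊂ U²` in `U₃`, `1 + 8ℤ₂ ⊂ ℤ₂^{*2}`), and `v₂(j) ≥ 15` is the uniform precision at which `α_E` is caught.
Census: F21 174/174 rows with `v₂(j) ≥ 15` have `z_2 = 1`; FAM 990/990, of which 970 have `c₄ = 0` (`j = 0`, CM, `α_E = 9·□` on the nose — outside the crux)
and 20 have `c₄ ≠ 0`; below 15 both values occur (`v₂(j) = 10`: 27 + 48 rows `z_2 = 1`, 20 + 22 rows `z_2 = 0`; `v₂(j) ∈ {11,…,14}`: all `z_2 = 0`).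
Why it might fail: the threshold 15 is read off the data (sharp there: `v₂(j) = 14` has 69 + 24 rows with `z_2 = 0`); the continuity proof gives SOME threshold per
Kodaira type and 15 must be checked to be enough in each.  Cheapest falsifier: one additive curve with `v₂(j) ≥ 15`, `z_2 = 0`. [cite: SilvermanAEC2009, X.§1] -/
def BlindSpotLocallyTrivialAtTwoOfDeepJ : Prop :=
  ∀ (W : WeierstrassCurve ℚ) [W.IsElliptic] [W.IsGloballyMinimal], (∀ n : ℕ, W.HasSurjectiveModNGaloisRep ((2 ^ n : ℕ) : ℤ)) →
    AdditiveOddAtTwo W → W.c₄ ≠ 0 → 15 + padicValRat 2 W.Δ ≤ 3 * padicValRat 2 W.c₄ →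
    ∀ x : galH1Torsion W ((2 ^ 1 : ℕ) : ℤ), DiesOnDivisionField W 1 2 x →
      resTorsion W ((primePlace 2).adicCompletion ℚ) ((2 ^ 1 : ℕ) : ℤ) x = 0

/-- Support **S-23t `NoTwoTorsionAtTwoTameCubic`** (known in substance; Serre's mass formula / tame inertia on `E[2]`): if `f` has no root in `ℚ₂` then the cubic
field `L ⊗ ℚ₂` is TAMELY ramified, i.e. `Δ ∈ 4^k(1+8ℤ)` (`U₃`) or `Δ ∈ 4^k(5+8ℤ)` (`R₃`): a wildly ramified `S₃`-closure would contain a ramified quadratic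
field fixed by the `3`-cycle, but a ramified cubic over `ℚ₂` is `ℚ₂(2^{1/3})·`unit, whose closure is `ℚ₂(ζ₃, 2^{1/3})` with quadratic subfield `ℚ₂(√-3) = ℚ₂(√5)`.
Census: all 460 + 804 `nr = 0` rows have `u ∈ {1,5}`, `v₂(Δ)` even.  [cite: Serre1979, Ch. IV] [cite: SilvermanAEC2009, VIII.§1] -/
def NoTwoTorsionAtTwoTameCubic : Prop :=
  ∀ (W : WeierstrassCurve ℚ) [W.IsElliptic] [W.IsGloballyMinimal], NoTwoTorsionAtTwo W → DeltaClass W 1 ∨ DeltaClass W 5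

/-- The CLOSED-FORM additive law as one predicate: `AdditiveLawAtTwo W` ⟺ (predicted) `x_2(E) = 1`. -/
def AdditiveLawAtTwo (W : WeierstrassCurve ℚ) [W.IsElliptic] : Prop :=
  (NoTwoTorsionAtTwo W ∧ DeltaClass W 5 ∧ ¬ TameCubicExceptional W) ∨
  (HasTwoTorsionAtTwo W ∧ DeltaRamifiedAtTwo W ∧ ∃ m : ℤ, W.Δ = 64 * m ∧ m % 8 = 7) ∨
  (HasTwoTorsionAtTwo W ∧ DeltaClass W 5 ∧ padicValRat 2 W.c₄ ≠ 5)

/-- **ES-23 `BlindSpotBitAtTwoAdditiveDecided` (the target of §23: on the additive-at-2, `c₂`-odd part of the `23715` slice the blind-spot bit `x_2` is an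
explicit function of the minimal model).**  Kernel glue below derives it from ES-22fα, ES-23a, ES-23c, ES-23d, S-23t and the square-class trichotomy S-23q. -/
def BlindSpotBitAtTwoAdditiveDecided : Prop :=
  ∀ (W : WeierstrassCurve ℚ) [W.IsElliptic] [W.IsGloballyMinimal], (∀ n : ℕ, W.HasSurjectiveModNGaloisRep ((2 ^ n : ℕ) : ℤ)) →
    AdditiveOddAtTwo W →
    ∀ x : galH1Torsion W ((2 ^ 1 : ℕ) : ℤ), x ≠ 0 → DiesOnDivisionField W 1 2 x →
      (x ∈ selmerLocalKer W ((primePlace 2).adicCompletion ℚ) ((2 ^ 1 : ℕ) : ℤ) ↔ AdditiveLawAtTwo W)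

/-- Support **S-23q `DeltaSquareClassTrichotomyAtTwo`** — RETYPED by the typer as REF1 §135's repair C′ (R1, mandatory; the ONLY statement deviation from
the sketch): the sketch's binder `(∀ n, W.HasSurjectiveModNGaloisRep (2^n)) →` is REPLACED by `AdditiveOddAtTwo W →` (the hypothesis the glue has in scope).
AS -es TYPED IT (surjectivity, no reduction hypothesis) the statement is FALSE — REF1 witness Cremona 1055a1 = [1,1,1,0,−8] (good ordinary at 2,
Δ = −26375 ≡ 1 (mod 8) so `DeltaClass W 1`, three ℤ₂-roots ≡ 12, 19, 28 (mod 64) so `HasTwoTorsionAtTwo W`, ρ_{E,2^∞} onto): a global S₃ image says nothing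
about the decomposition group at 2, so the sketch's rationale «ρ̄_{E,2} onto ⇒ Δ ∉ ℚ₂^{×2}» had to go.  C′ is THEOREM-GRADE (REF1 §135; THEOREM-CANDIDATE,
formal group + c₂ odd): on a minimal model a 2-torsion point lies in E₁(ℚ₂) iff X(T) = 4x(T) ∈ ℤ₂^×; Ê(2ℤ₂)[2] ≤ ℤ⁄2; if E[2] ⊂ E(ℚ₂) the three X(T_i) sum to
−b₂, even because additive ⇒ 2 ∣ c₄ ≡ b₂² (mod 8), so an even number of T_i lie in E₁, hence none; but c₂ odd puts E[2] inside E₀(ℚ₂) and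
E₀⁄E₁ ≅ 𝔾_a(𝔽₂) = ℤ⁄2 cannot receive (ℤ⁄2)² — so E(ℚ₂)[2] ≠ (ℤ⁄2)², and one ℚ₂-root with Δ ∈ ℚ₂^{×2} would force three; whence Δ ∉ 4^k(1+8ℤ₂):
for additive `c₂`-odd `E` with `E(ℚ₂)[2] ≠ 0`, either `ℚ₂(√Δ)` is ramified or `Δ ∈ 4^k(5+8ℤ)`.  Census: 14 625 -es rows + 1 872⁄1 872 additive nr = 3 box
curves (REF1 `out/s23q_scan.out`).  REF1 `ref1_s23q'_restricted_of_s23q`: nothing downstream is lost by the repair. [folklore] [cite: SilvermanAEC2009, IV.6.1, VII.2.1] -/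
def DeltaSquareClassTrichotomyAtTwo : Prop :=
  ∀ (W : WeierstrassCurve ℚ) [W.IsElliptic] [W.IsGloballyMinimal], AdditiveOddAtTwo W →
    HasTwoTorsionAtTwo W → DeltaRamifiedAtTwo W ∨ DeltaClass W 5

/-- Elementary: `4^a c ≠ 4^b d` for `c` odd and `a < b`. -/
theorem four_pow_mul_ne_of_lt (a b : ℕ) (c d : ℤ) (hc : c % 2 = 1) (hab : a < b) : (4 : ℤ) ^ a * c ≠ (4 : ℤ) ^ b * d := by
  intro h
  have hsplit : (4 : ℤ) ^ b * d = (4 : ℤ) ^ a * ((4 : ℤ) ^ (b - a) * d) := by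
    rw [← mul_assoc, ← pow_add, Nat.add_sub_cancel' hab.le]
  rw [hsplit] at h
  have h' : c = (4 : ℤ) ^ (b - a) * d := mul_left_cancel₀ (by positivity : (4 : ℤ) ^ a ≠ 0) h
  have h2 : (2 : ℤ) ∣ c := by
    rw [h']
    exact Dvd.dvd.mul_right (dvd_pow (by norm_num : (2 : ℤ) ∣ 4) (Nat.sub_ne_zero_of_lt hab)) d
  omega

/-- Elementary: the residue classes `1` and `5` are distinct square classes (used to discharge the `U₃` branch against `DeltaClass W 5`). -/
theorem deltaClass_one_five_disjoint (W : WeierstrassCurve ℚ) (h1 : DeltaClass W 1) (h5 : DeltaClass W 5) : False := by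
  obtain ⟨k, m, hk, hm⟩ := h1
  obtain ⟨k', m', hk', hm'⟩ := h5
  have heq : (4 : ℚ) ^ k * m = (4 : ℚ) ^ k' * m' := by rw [← hk, ← hk']
  have heqZ : (4 : ℤ) ^ k * m = (4 : ℤ) ^ k' * m' := by exact_mod_cast heq
  rcases lt_trichotomy k k' with hlt | rfl | hgt
  · exact four_pow_mul_ne_of_lt k k' m m' (by omega) hlt heqZ
  · have hmm : m = m' := mul_left_cancel₀ (by positivity : (4 : ℤ) ^ k ≠ 0) heqZ
    omega
  · exact four_pow_mul_ne_of_lt k' k m' m (by omega) hgt heqZ.symm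

/-- Glue (kernel): the four cell laws + the two support statements decide `x_2` on the additive `c₂`-odd slice. -/
theorem blindSpotBitAtTwoAdditiveDecided_of
    (hU : BlindSpotNotKummerAtTwoAdditiveUnramifiedCubic) (hR : BlindSpotKummerAtTwoAdditiveTameCubicIff)
    (hram : BlindSpotKummerAtTwoAdditiveTorsionRamifiedIff) (hunr : BlindSpotKummerAtTwoAdditiveTorsionUnramifiedIff)
    (ht : NoTwoTorsionAtTwoTameCubic) (hq : DeltaSquareClassTrichotomyAtTwo) :
    BlindSpotBitAtTwoAdditiveDecided := by
  intro W _ _ hsurj hadd x hx hdies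
  obtain ⟨hng, hnm, hodd⟩ := hadd
  by_cases h0 : NoTwoTorsionAtTwo W
  · -- cubic field: U₃ or R₃
    have hnot1 : ¬ HasTwoTorsionAtTwo W := by
      rintro ⟨P, hP0, hP2⟩; exact hP0 (h0 P hP2)
    rcases ht W h0 with h1 | h5
    · -- U₃: x_2 = 0, and the law predicate is false
      have hx0 : x ∉ selmerLocalKer W ((primePlace 2).adicCompletion ℚ) ((2 ^ 1 : ℕ) : ℤ) :=
        fun hloc ↦ hx (hU W hsurj hng hnm hodd h0 h1 x hloc hdies)
      constructor
      · intro hloc; exact absurd hloc hx0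
      · rintro (⟨-, h5, -⟩ | ⟨hT, -, -⟩ | ⟨hT, -, -⟩)
        · exact (deltaClass_one_five_disjoint W h1 h5).elim
        · exact (hnot1 hT).elim
        · exact (hnot1 hT).elim
    · have key := hR W hsurj ⟨hng, hnm, hodd⟩ h0 h5 x hx hdies
      rw [key]
      constructor
      · intro hne; exact Or.inl ⟨h0, h5, hne⟩
      · rintro (⟨-, -, hne⟩ | ⟨hT, -, -⟩ | ⟨hT, -, -⟩)
        · exact hne
        · exact (hnot1 hT).elim
        · exact (hnot1 hT).elim
  · -- a rational 2-torsion point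
    have hT : HasTwoTorsionAtTwo W := by
      by_contra hno
      apply h0
      intro P hP2
      by_contra hP0
      exact hno ⟨P, hP0, hP2⟩
    rcases hq W ⟨hng, hnm, hodd⟩ hT with hr | h5  -- REF1 §135 R1: the one patched call (was `hq W hsurj hT`)
    · have key := hram W hsurj ⟨hng, hnm, hodd⟩ hT hr x hx hdies
      rw [key]
      constructor
      · intro h7; exact Or.inr (Or.inl ⟨hT, hr, h7⟩)
      · rintro (⟨hn, -, -⟩ | ⟨-, -, h7⟩ | ⟨-, h5, hc⟩)
        · exact (h0 hn).elim
        · exact h7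
        · -- both ramified and class 5: then `v₂Δ` even and `m ≡ 5`, contradiction with ramified unless … ; use the unramified law instead
          exact ((hunr W hsurj ⟨hng, hnm, hodd⟩ hT h5 x hx hdies).2 hc) |> fun hloc ↦ (key.1 hloc)
    · have key := hunr W hsurj ⟨hng, hnm, hodd⟩ hT h5 x hx hdies
      rw [key]
      constructor
      · intro hc; exact Or.inr (Or.inr ⟨hT, h5, hc⟩)
      · rintro (⟨hn, -, -⟩ | ⟨-, hr, h7⟩ | ⟨-, -, hc⟩)
        · exact (h0 hn).elim
        · exact (hram W hsurj ⟨hng, hnm, hodd⟩ hT hr x hx hdies).2 h7 |> fun hloc ↦ key.1 hloc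
        · exact hc

/-! ## Global consequences on the ADDITIVE THIN FAMILY `𝔉_add` (MEMO-es §23.7): additive at `2`, every odd bad prime additive, odd Tamagawa product, `Δ < 0`,
`ρ_{E,2^∞}` onto.  As in §22.12 every local bit other than `x_2` is `1`, so `b(E) = x_2(E)` = `AdditiveLawAtTwo`. -/

/-- **ES-23g `BlindSpotSelmerIffKummerAtTwoOnAdditiveThinFamily` (candidate, THEOREM on paper from the trivial local laws at `∞` (`Δ<0`), at odd additive `p`
with `c_p` odd (`H¹(ℚ_p, E[2]) = 0`) and at good `p ∤ 2Δ` (inflation from `ℚ(E[4])` is unramified); NEW as a statement): on `𝔉_add` a class dying on `ℚ(E[4])`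
is `2`-Selmer iff it satisfies the local Kummer condition at `2`.**  Why it might fail: only a slip in the odd-additive triviality (`E(ℚ_p)[2] ↪ Φ_p × 𝔾_a(𝔽_p) × Ê`,
all `2`-torsion-free for `p` odd, `c_p` odd).  [cite: SilvermanAEC2009, VII.§6, X.§4] [cite: SilvermanAEC2009, Prop. VII.2.1, Prop. VII.3.1, Prop. VII.5.1(c)]
(REF2 v40-add2 §1.5: cite slot repaired — Kramer 1981 Prop. 3 is the odd-residue-characteristic GOOD-reduction index, not the odd-additive triviality) -/
def BlindSpotSelmerIffKummerAtTwoOnAdditiveThinFamily : Prop :=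
  ∀ (W : WeierstrassCurve ℚ) [W.IsElliptic] [W.IsGloballyMinimal], (∀ n : ℕ, W.HasSurjectiveModNGaloisRep ((2 ^ n : ℕ) : ℤ)) →
    AdditiveOddAtTwo W → (∀ (p : ℕ) [Fact p.Prime], ¬ W.HasMultiplicativeReductionAtPrime p) → Odd W.tamagawaProduct → W.Δ < 0 →
    ∀ x : galH1Torsion W ((2 ^ 1 : ℕ) : ℤ), DiesOnDivisionField W 1 2 x →
      (x ∈ selmerGroup W ((2 ^ 1 : ℕ) : ℤ) ↔ x ∈ selmerLocalKer W ((primePlace 2).adicCompletion ℚ) ((2 ^ 1 : ℕ) : ℤ))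

/-- **ES-23h `ShaTwoNontrivialOnAdditiveThinFamily` (UNCONDITIONAL COROLLARY shape, candidate, NEW): on `𝔉_add`, if the law says `x_2 = 1` and `rank E(ℚ) = 0`
then `Ш(E/ℚ)[2] ≠ 0`** (the blind spot is Selmer by ES-23g, non-zero since `ρ̄_{E,4}` is onto, and not a Kummer image as `E(ℚ)/2 = 0`).  BSD-consistency census
(Cremona `allbsd`, all of `N < 500 000`; `ρ̄_{E,4}` onto by the Dokchitser² criterion): the 16 rank-0 members with `x_2 = 1` have `Ш_an ∈ {4 (9×), 16 (6×), 100}`;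
of the 215 rank-0 members with `x_2 = 0`, 210 have odd `Ш_an`.  Cheapest falsifier: a rank-0 `𝔉_add` curve with `AdditiveLawAtTwo` and odd `Ш_an` (0/16).
[cite: SilvermanAEC2009, Thm X.4.2] -/
def ShaTwoNontrivialOnAdditiveThinFamily : Prop :=
  ∀ (W : WeierstrassCurve ℚ) [W.IsElliptic] [W.IsGloballyMinimal], (∀ n : ℕ, W.HasSurjectiveModNGaloisRep ((2 ^ n : ℕ) : ℤ)) →
    AdditiveOddAtTwo W → (∀ (p : ℕ) [Fact p.Prime], ¬ W.HasMultiplicativeReductionAtPrime p) → Odd W.tamagawaProduct → W.Δ < 0 →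
    AdditiveLawAtTwo W → W.mordellWeilRank = 0 →
      ∃ s : W.galH1, s ∈ W.sha ∧ s ≠ 0 ∧ (2 : ℤ) • s = 0

/-- **ES-23i `BlindSpotIsKummerImageOnAdditiveThinFamilyOfShaTwoTrivial` (RANK-ONE READING, candidate, NEW): on `𝔉_add` with `x_2 = 1` and `Ш(E)[2] = 0`, the
blind spot is a Kummer image (rank one: `ξ_E = δ(P_gen)`, i.e. `P_gen` becomes `2`-divisible over `ℚ(E[4])`).**  Census: 96/96 rank-1 (certified square roots in
`ℚ(θ)`) and 8/8 rank-2 members; control `x_2 = 0`: `ξ_E ∉ δ(E(ℚ))` 105/105.  [cite: SilvermanAEC2009, Thm X.4.2] -/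
def BlindSpotIsKummerImageOnAdditiveThinFamilyOfShaTwoTrivial : Prop :=
  ∀ (W : WeierstrassCurve ℚ) [W.IsElliptic] [W.IsGloballyMinimal], (∀ n : ℕ, W.HasSurjectiveModNGaloisRep ((2 ^ n : ℕ) : ℤ)) →
    AdditiveOddAtTwo W → (∀ (p : ℕ) [Fact p.Prime], ¬ W.HasMultiplicativeReductionAtPrime p) → Odd W.tamagawaProduct → W.Δ < 0 →
    AdditiveLawAtTwo W → (∀ s : W.galH1, s ∈ W.sha → (2 : ℤ) • s = 0 → s = 0) →
    ∀ x : galH1Torsion W ((2 ^ 1 : ℕ) : ℤ), DiesOnDivisionField W 1 2 x →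
      torsionH1ToH1 W ((2 ^ 1 : ℕ) : ℤ) x = 0

/-- Glue (kernel): ES-23i from ES-23g, the decided bit ES-23 and the PROVED `Sel₂ ↠ Ш[2]` theorem `WeierstrassCurve.map_torsionH1ToH1_selmerGroup_holds`. -/
theorem blindSpotIsKummerImageOnAdditiveThinFamily_of (hg : BlindSpotSelmerIffKummerAtTwoOnAdditiveThinFamily) (hd : BlindSpotBitAtTwoAdditiveDecided) :
    BlindSpotIsKummerImageOnAdditiveThinFamilyOfShaTwoTrivial := by
  intro W _ _ hsurj hadd hnomult hodd hneg hlaw hsha0 x hdies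
  by_cases hx : x = 0
  · subst hx; simp
  have hloc : x ∈ selmerLocalKer W ((primePlace 2).adicCompletion ℚ) ((2 ^ 1 : ℕ) : ℤ) := (hd W hsurj hadd x hx hdies).2 hlaw
  have hsel : x ∈ selmerGroup W ((2 ^ 1 : ℕ) : ℤ) := (hg W hsurj hadd hnomult hodd hneg x hdies).2 hloc
  have hmem : torsionH1ToH1 W ((2 ^ 1 : ℕ) : ℤ) x ∈ (selmerGroup W ((2 ^ 1 : ℕ) : ℤ)).map (torsionH1ToH1 W ((2 ^ 1 : ℕ) : ℤ)) :=
    AddSubgroup.mem_map_of_mem _ hsel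
  rw [WeierstrassCurve.map_torsionH1ToH1_selmerGroup_holds W (by norm_num)] at hmem
  obtain ⟨hsha1, htor⟩ := AddSubgroup.mem_inf.1 hmem
  exact hsha0 _ hsha1 (by simpa using htor)

/-! ## Addendum (g14, 20:0xZ): the COMPLETE `z₂`-law on the additive slice -/

/-- The two `z`-exceptional sub-cells (twists of each other by `±2`): Kodaira I0*(f₂=4, v₂Δ=8) with `v₂(c₄) = 6`, and II*(f₂=6, v₂Δ=14) with `v₂(c₄) = 8`,
each with `c₄′ ≡ 1 (mod 4)` (`c₄′ = c₄/2^{v₂c₄}`).  On them `v₂(j) ∈ {10, 10}` `< 15` and yet `loc₂ ξ_E = 0`. -/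
def DeepTwistCell (W : WeierstrassCurve ℚ) : Prop :=
  (padicValRat 2 W.Δ = 8 ∧ ∃ m : ℤ, W.c₄ = 64 * m ∧ m % 4 = 1) ∨ (padicValRat 2 W.Δ = 14 ∧ ∃ m : ℤ, W.c₄ = 256 * m ∧ m % 4 = 1)

/-- **ES-23z′ `BlindSpotLocallyTrivialAtTwoAdditiveIff` (candidate, EMPIRICAL two populations, NEW; refines ES-23z to an iff): additive at `2`, `c₂` odd, `c₄ ≠ 0` ⇒
`loc₂ ξ_E = 0` iff `v₂(j) ≥ 15` or (`E(ℚ₂)[2] = 0`, `Δ ∈ 4^k(5+8ℤ₂)` and `DeepTwistCell`).**  Census: F21 1002/1002 (z₂ = 1 on 201 rows = 174 with `v₂(j) ≥ 15` + 19 in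
I0*(4,8)∧c₄′≡1 (4) + 8 in II*(6,14)∧v₂c₄=8∧c₄′≡1 (4)); FAM 1640/1640 (1038 = 990 + 20 + 28).  `z₂` is twist-invariant (1001/1001 orbits, kit `j315610`), and so is this
predicate on the sampled orbits.  Why it might fail: the residue condition `c₄′ mod 4` is mined from 35 + 30 and 12 + 40 rows; II*(6,14)∧v₂c₄=9 (`v₂(j) = 13`, 6 rows, all
z₂ = 0) sits between the two clauses and a finer digit could matter in unsampled residue classes.  Cheapest falsifier: one additive curve with z₂ ≠ prediction (< 1 s). [cite: SilvermanAEC2009, X.§1] -/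
def BlindSpotLocallyTrivialAtTwoAdditiveIff : Prop :=
  ∀ (W : WeierstrassCurve ℚ) [W.IsElliptic] [W.IsGloballyMinimal], (∀ n : ℕ, W.HasSurjectiveModNGaloisRep ((2 ^ n : ℕ) : ℤ)) →
    AdditiveOddAtTwo W → W.c₄ ≠ 0 →
    ∀ x : galH1Torsion W ((2 ^ 1 : ℕ) : ℤ), x ≠ 0 → DiesOnDivisionField W 1 2 x →
      (resTorsion W ((primePlace 2).adicCompletion ℚ) ((2 ^ 1 : ℕ) : ℤ) x = 0 ↔
        (15 + padicValRat 2 W.Δ ≤ 3 * padicValRat 2 W.c₄) ∨ (NoTwoTorsionAtTwo W ∧ DeltaClass W 5 ∧ DeepTwistCell W))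

/-- Glue (kernel): ES-23z′ ⇒ ES-23z on non-zero classes (the zero class is trivially locally trivial). -/
theorem blindSpotLocallyTrivialAtTwoOfDeepJ_of_iff (h : BlindSpotLocallyTrivialAtTwoAdditiveIff) : BlindSpotLocallyTrivialAtTwoOfDeepJ := by
  intro W _ _ hsurj hadd hc4 hj x hdies
  by_cases hx : x = 0
  · subst hx; simp
  · exact (h W hsurj hadd hc4 x hx hdies).2 (Or.inl hj)

end Summit.BirchSwinnertonDyer.Rank1Residual.F1Sign2.BlindSpotLocalLawsAtTwoAdditive
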